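import Literature.AlgebraicGeometry.RelativeSpec.GeometricQuotientFreeTorsor
import Mathlib.FieldTheory.IsAlgClosed.AlgebraicClosure
import HarnessLib

/-!
# Freeness on geometric points implies the Chase–Harrison–Rosenberg freeness on affine charts
# (SGA 1, Exp. V, Prop. 2.6 (i): «les groupes d'inertie des points de `X` sont réduits à l'unité»)

The free-quotient files of the tree (`RelativeSpec/FreeQuotient*`, `GeometricQuotientFreeFlat`,
`GeometricQuotientFreeEtale`, `GeometricQuotientFreeBaseChange`, `GeometricQuotientFreeTorsor`) take
freeness in the RING form of Chase–Harrison–Rosenberg / Greither (Ch. 0 Thm. 1.6 (iv)): on every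
affine chart `Γ(X, r⁻¹U)` and for every `g ≠ 1` the elements `g·b − b` generate the unit ideal. This
file derives that condition from the GEOMETRIC one consumers usually hold — `G` acts without fixed
points on the geometric points of `X` (trivial inertia, SGA 1 V 2.6 (i); e.g. a level-`N ≥ 3`
structure kills the automorphisms of a polarised abelian variety, Serre's lemma): if for every
algebraically closed field `Ω` and every `Ω`-valued point `x` of `X`, `x ≫ g ≠ x` for `g ≠ 1`, then
the ring condition holds on every affine chart `r⁻¹U` (`ActionOver.span_act_sub_eq_top_of_forall_ne`,
`ActionOver.free_of_forall_comp_aut_ne`). Proof: were the ideal generated by the `g·b − b` proper,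
a maximal ideal `𝔪` above it would be `g`-stable with `g` acting trivially on `Γ(X, r⁻¹U)/𝔪`, and the
geometric point `Spec Ω → Spec (Γ/𝔪) → r⁻¹U ⊆ X`, `Ω = (Γ/𝔪)^alg`, would be fixed by `g⁻¹`
(★ `ActionOver.specMap_act_comp_ι`: `Spec (act g) = g⁻¹` on the chart). Conversely freeness on charts
gives freeness on ALL field-valued points (★ `IsGeometricQuotient.eq_one_of_comp_aut_eq_of_free`), so
the two notions agree (`ActionOver.free_iff_forall_comp_aut_ne`).

Everything is proved; no named facts, no definitions.

Mathlib searched (pin): `Ideal.exists_le_maximal`, `Ideal.Quotient.field`, `Ideal.Quotient.eq`,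
`AlgebraicClosure`, `Spec.map_comp`, `Scheme.Opens.ι`, `IsAffineOpen.isoSpec` (all used).

## References

* A. Grothendieck, *SGA 1*, Exp. V, §2, Prop. 2.6 (i), Déf. 2.7. [SGA1]
* C. Greither, LNM 1534 (1992), Ch. 0, Thm. 1.6 (iv) (p. 3). [Greither1992CyclicGalois]
* D. Mumford, *Abelian Varieties* (1970), §7 Thm. p. 66; §12. [MumfordAV1970]
-/

noncomputable section

universe u

open CategoryTheory Limits AlgebraicGeometry TopologicalSpace Opposite

namespace Literature.AlgebraicGeometry.RelativeSpec.ActionOver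

variable {X Y : Scheme.{u}} {r : X ⟶ Y} {G : Type u} [Group G] (ρ : ActionOver r G)

set_option backward.isDefEq.respectTransparency false

/-- **Trivial inertia on geometric points ⇒ the `g·b − b` generate the unit ideal** on an affine
chart `r⁻¹U`: otherwise a maximal ideal `𝔪 ⊇ (g·b − b)_b` of `Γ(X, r⁻¹U)` gives the geometric point
`Spec (Γ/𝔪)^alg → r⁻¹U ⊆ X` fixed by `g⁻¹`. [cite: SGA1, Exp. V Prop. 2.6 (i)]
[cite: Greither1992CyclicGalois, Ch. 0 Thm. 1.6 (iv) (p. 3)] -/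
theorem span_act_sub_eq_top_of_forall_ne (U : Y.Opens) (hU : IsAffineOpen (r ⁻¹ᵁ U)) (g : G)
    (hpt : ∀ (Ω : Type u) [Field Ω] [IsAlgClosed Ω] (x : Spec (.of Ω) ⟶ X),
      x ≫ (ρ.aut g⁻¹).hom ≠ x) :
    Ideal.span (Set.range fun b : Γ(X, r ⁻¹ᵁ U) ↦ ρ.act g U b - b) = ⊤ := by
  by_contra hne
  obtain ⟨M, hM, hle⟩ := Ideal.exists_le_maximal _ hne
  letI : Field (Γ(X, r ⁻¹ᵁ U) ⧸ M) := Ideal.Quotient.field M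
  let Ω : Type u := AlgebraicClosure (Γ(X, r ⁻¹ᵁ U) ⧸ M)
  let ψ : Γ(X, r ⁻¹ᵁ U) →+* Ω :=
    (algebraMap (Γ(X, r ⁻¹ᵁ U) ⧸ M) Ω).comp (Ideal.Quotient.mk M)
  -- `g` acts trivially modulo `𝔪`
  have hψ : ψ.comp (ρ.act g U) = ψ := by
    ext b
    change algebraMap _ Ω (Ideal.Quotient.mk M (ρ.act g U b)) = algebraMap _ Ω (Ideal.Quotient.mk M b)
    rw [Ideal.Quotient.eq.mpr (hle (Ideal.subset_span ⟨b, rfl⟩))]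
  -- the geometric point through the chart, fixed by `g⁻¹`
  let x : Spec (.of Ω) ⟶ X := Spec.map (CommRingCat.ofHom ψ) ≫ hU.isoSpec.inv ≫ (r ⁻¹ᵁ U).ι
  refine hpt Ω x ?_
  have key : Spec.map (CommRingCat.ofHom ψ) ≫ Spec.map (CommRingCat.ofHom (ρ.act g U)) =
      Spec.map (CommRingCat.ofHom ψ) := by
    rw [← Spec.map_comp, ← CommRingCat.ofHom_comp, hψ]
  change (Spec.map (CommRingCat.ofHom ψ) ≫ hU.isoSpec.inv ≫ (r ⁻¹ᵁ U).ι) ≫ (ρ.aut g⁻¹).hom =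
    Spec.map (CommRingCat.ofHom ψ) ≫ hU.isoSpec.inv ≫ (r ⁻¹ᵁ U).ι
  rw [Category.assoc, Category.assoc, ← ρ.specMap_act_comp_ι g U hU, ← Category.assoc, key]

/-- **Free on geometric points ⇒ free on the affine charts** (the hypothesis `hfree` of
★ `IsGeometricQuotient.isFinite_of_free` / `flat_of_free` / `etale_of_free` /
`isGeometricQuotient_baseChange_of_free` / `nonempty_isColimit_cofan_graph_of_free`): if no `g ≠ 1` fixes
an algebraically-closed-field-valued point of `X`, then on every affine `U ⊆ Y` (`r` affine) and for
every `g ≠ 1` the `g·b − b` generate the unit ideal of `Γ(X, r⁻¹U)`.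
[cite: SGA1, Exp. V Prop. 2.6 (i), Déf. 2.7] -/
theorem free_of_forall_comp_aut_ne [IsAffineHom r]
    (hpt : ∀ (Ω : Type u) [Field Ω] [IsAlgClosed Ω] (x : Spec (.of Ω) ⟶ X) (g : G), g ≠ 1 →
      x ≫ (ρ.aut g).hom ≠ x) :
    ∀ (U : Y.Opens), IsAffineOpen U → ∀ g : G, g ≠ 1 →
      Ideal.span (Set.range fun b : Γ(X, r ⁻¹ᵁ U) ↦ ρ.act g U b - b) = ⊤ :=
  fun U hU g hg => ρ.span_act_sub_eq_top_of_forall_ne U (hU.preimage r) g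
    fun Ω _ _ x => hpt Ω x g⁻¹ (inv_ne_one.mpr hg)

/-- **Freeness on the affine charts is equivalent to trivial inertia on field-valued points** (for
`r` affine; ⇐ `free_of_forall_comp_aut_ne`, ⇒ ★ `IsGeometricQuotient.eq_one_of_comp_aut_eq_of_free`,
valid for every field `Ω`). [cite: SGA1, Exp. V Prop. 2.6 (i)] -/
theorem free_iff_forall_comp_aut_ne [IsAffineHom r] :
    (∀ (U : Y.Opens), IsAffineOpen U → ∀ g : G, g ≠ 1 →
        Ideal.span (Set.range fun b : Γ(X, r ⁻¹ᵁ U) ↦ ρ.act g U b - b) = ⊤) ↔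
      ∀ (Ω : Type u) [Field Ω] (x : Spec (.of Ω) ⟶ X) (g : G), g ≠ 1 → x ≫ (ρ.aut g).hom ≠ x :=
  ⟨fun hfree _ _ x _ hg hx => hg (IsGeometricQuotient.eq_one_of_comp_aut_eq_of_free hfree x hx),
    fun hpt => ρ.free_of_forall_comp_aut_ne fun Ω _ _ x g hg => hpt Ω x g hg⟩

end Literature.AlgebraicGeometry.RelativeSpec.ActionOver

end
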